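import Summits.CriticalPhenomena.PercolationContinuityZ3.Theorems.FK.Transplant.FHSlabPercolationTools
import Summits.CriticalPhenomena.PercolationContinuityZ3.Theorems.FK.Transplant.FHFreePercolation
import HarnessLib

/-!
# FRONTIER TRANSPLANT, calibration leaf II: FREE SLAB PERCOLATION FORCES THE HYPOTHESIS OF RECORD
# (`Π(p, L) → FH d q p` for every `q ≥ 1`, `d ≥ 3`); hence `p̂_c(q) < p → FH d q p`, the Conjecture (5.103) form, and —
# given Bodineau's theorem `p̂_c(2) = p_c(2)` — for `q = 2` (the Ising case) binder 1 is DECIDED: `FH d 2 p ↔ p_c(2) < p ↔ 0 < θ⁰(p,2)`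

Support file (`--supports stmt-CriticalPhenomena-4575`, helper) of the FRONTIER TRANSPLANT sub-cell
(`fk-continuity/transplant/`, seat `prim-bschramm-fkt-p2`, rows 3–4 lineage); builds on p205010 (kernel theorem,
internal audit signed; external expert review pending). No definitions, no named facts introduced, no sorries;
standard axioms. Tools: `Transplant/FHSlabPercolationTools.lean`.
Registered R58 (cell INBOX l.4308, 2026-08-22); registry row T1s; lead label T1s-B (fkt-lead L17, l.4322).

HONEST FRAMING (page 1, cell rule). The transplant's theorem of record `ufsc0_of_freeBoundaryHypothesis_r3`
(p248245, END STATE « 2 / 0 ☑ ») is CONDITIONAL on FH AND on TP_FK = `KNFreeTargetHittable d q p`, both OPEN at the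
same `p` for `q > 1` NEAR `p_c(q)` (⇔ GRC Conj. (5.103) via K1; barrier note
`Literature.Barriers.CriticalPhenomena.SamePFreeBoundaryCriteria`, FBN-01, cited first and IMPORTED here for its
objects `FKSlabPercolation` = `Π(p, L)`, `fkSlabCriticalProb` = `p̂_c(q)` and its NAMED FACT `Bodineau2005_slabThreshold`);
the transplant is a typed reduction, not a proof of FK continuity, and THIS FILE DOES NOT CHANGE THAT: for general
`q ≥ 1` it proves FH only ABOVE THE SLAB THRESHOLD `p̂_c(q)` — whether `p̂_c(q) = p_c(q)` IS Conjecture (5.103),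
open for `q ∈ (1, 2)` and `q > 2` (a theorem in print for `q ∈ {1, 2}` only) — and it says nothing about TP_FK. It is
a CALIBRATION leaf, the SUFFICIENCY side of K1 at the level of slabs, companion of T1c (`FHFreePercolation.lean`:
the necessity side `FH d q p → 0 < θ⁰(p,q)`) and of T1 (`FHBernoulliWindow.lean`: FH in the Bernoulli window
`p > q·p_c(ℤ^d)/(1+(q-1)p_c(ℤ^d))`, which "says nothing about FH on `(p_c(q), q·p_c/(1+(q-1)p_c)]`, where the
record theorem would bite" — the present leaf lowers that threshold to `p̂_c(q)`, i.e. to `p_c(q)` itself exactly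
when (5.103) holds). Every theorem concluding `FH` below carries a DISPLAYED hypothesis (`Π(p, L)` / `p̂_c(q) < p` /
`p̂_c(q) = p_c(q) ∧ p_c(q) < p` / `Bodineau2005_slabThreshold ∧ p_c(2) < p`); the `q = 2` theorems are CONDITIONAL on
the named fact `Bodineau2005_slabThreshold` (Bodineau 2005 Thm. 2.1 / Severo 2024 Thm. 1.1 — a published theorem the
tree does not prove; the gate records them as conditional results). NOT a rule-5 discharge of binder 1 (whose
standing binders are `3 ≤ d, 1 ≤ q, p ∈ (0,1)`), NOT a re-cut, NOT `_r4`; `_r3` « 2 / 0 ☑ », n_open = 2, BINDER-OWNERS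
and FO-19 NO-GO unchanged.

## What is proved

* §1 placed slabs `σ_π S(L, N) + v` (a coordinate permutation followed by a translation; `S(L,N)` = the barrier note's
  `fkSlab d L N = {-L,…,L}^{d-2} × {-N,…,N}²`): membership, containment in `Λ_N`, disjointness of a stack, the face
  point `τ_a ℓ e_a + k e_c ∈ ℓF` of the quarter-face geometry, and `lattW p ≤ hitW` inside the hitting box.
* §2 **`isHittableFK_qfGeom_of_fkSlabPercolation`, `fh_of_fkSlabPercolation (hd : 3 ≤ d) (hq : 1 ≤ q)
  (hSP : FKSlabPercolation d p q L) : FH d q p`** — free slab percolation at thickness `L` (Grimmett's `Π(p, L)`,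
  (5.102)) makes every quarter-face geometry FK-hittable: for `ε > 0` take `n` with `(1-α)^n < ε` and
  `k = ℓ₀ = (2L+1)n + L`; inside `ℓQ = Λ_ℓ` the `n` disjoint slabs `σ_π S(L, ℓ) + k_i e_c` (`π = (a, d-1)`, `c = π 0`,
  `k_i = τ_c (2L+1) i`) each contain a seed vertex `k_i e_c ∈ Λ_m` and a face vertex `τ_a ℓ e_a + k_i e_c ∈ ℓF` which
  the slab's own FREE law joins with probability `> α` (covariance under `Aut(ℤ^d)`, tools §2–§3); the sequential free
  trials (tools §4 = Grimmett (5.113)–(5.116)) give `φ(Λ_m ↔ ℓF in ℓQ) ≥ 1 - (1-α)^n > 1 - ε` under the free look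
  (free on `ℓQ`, seed wired).
* §3 **`fh_of_fkSlabCriticalProb_lt : p̂_c(q) < p → FH d q p`** (`d ≥ 3`, `q ≥ 1`; with T1c's `rcCriticalProb_le_of_fh`
  the threshold of binder 1 lies in `[p_c(q), p̂_c(q)]`), `le_fkSlabCriticalProb_of_not_fh`, and the Conjecture (5.103)
  form `fh_of_rcCriticalProb_lt_of_slabThreshold_eq : p̂_c(q) = p_c(q) → p_c(q) < p → FH d q p` (displayed hypothesis,
  NOT asserted), and `fh_iff_thetaFree_pos_of_samePFreeSlab`: under the same-`p` slab criterion (P) ⟹ (SP) at `p`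
  (the barrier theorem's displayed hypothesis) binder 1 is EQUIVALENT to `0 < θ⁰(p,q)` — T1c's converse for binder 1.
* §4 the Ising case `q = 2`, `d ≥ 3`, given `hB : Bodineau2005_slabThreshold`: **`fh_two_of_rcCriticalProb_lt :
  p_c(2) < p → FH d 2 p`**; **`fh_two_iff_rcCriticalProb_lt : FH d 2 p ↔ p_c(2) < p`** (with T1c's
  `not_fh_two_at_critical`, ADS 2015, and `rcCriticalProb_le_of_fh`); **`fh_two_iff_thetaFree_pos : FH d 2 p ↔
  0 < θ⁰(p, 2)`** (the programme's open content `0 < θ⁰(p,q) ⟹ FH ∧ TP_FK` (T1c) reduces, for `q = 2`, to its TP_FK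
  half); and **`ufsc0_two_of_targetHittable`**: for `p ∈ (p_c(2), 1)` the record's conclusion `∃ r, UFSC0 d 2 p r ε₀`
  follows from TP_FK ALONE — the record at `q = 2` with ONE open binder (conditional on TP_FK and the named fact).

Calibration value (K1): `p̂_c(q) < p ⟹ FH d q p ⟹ 0 < θ⁰(p, q) ⟹ p_c(q) ≤ p` (this file, T1c); so binder 1 is
decided off `[p_c(q), p̂_c(q)]`, an interval that Conjecture (5.103) collapses to the point `p_c(q)` (where binder 1
fails whenever `θ⁰(p_c(q), q) = 0`), and that IS a point for `q = 2` (Bodineau). Infinite-volume objects: NONE beyond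
T1c's (`thetaFree` = `inf_n sup_k` of free BOX probabilities; `rcCriticalProb` via the wired box limit), T1⁺.

## References

* G. Grimmett, *The Random-Cluster Model*, Springer 2006: Thm. (3.7); Thm. (3.21) eq. (3.22); Lemma (4.13); §4.3;
  §5.1 (5.1); §5.7 (pp. 123–130 of the print edition): (5.102), Conj. (5.103), Thm. (5.104) and its proof,
  eqs. (5.111)–(5.116). [Grimmett2006]
* Á. Pisztora, PTRF 104 (1996) 427–466 (slab percolation and renormalisation; cited through Grimmett §5.7). [Pisztora1996]
* T. Bodineau, *Slab percolation for the Ising model*, PTRF 132 (2005) 83–118, arXiv:math/0309300, Thm. 2.1. [Bodineau2005]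
* F. Severo, *Slab percolation for the Ising model revisited*, ECP 29 (2024), arXiv:2312.06831, §1, Thm. 1.1. [Severo2024]
* H. Duminil-Copin, V. Tassion, arXiv:1707.07626 (2019), §5 Question 5. [DuminilCopinTassion2019]
* M. Aizenman, H. Duminil-Copin, V. Sidoravicius, Comm. Math. Phys. 334 (2015), Thm. 1.2. [AizenmanDuminilCopinSidoraviciusCMP2015]
* G. Kozma, S. Nitzan, arXiv:2401.12397 (2024), §4 p. 16 (hittable geometry), Lemma 9, Theorem 6. [KozmaNitzan2024]
-/
noncomputable section

open MeasureTheory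
open scoped ENNReal Classical

namespace Summit.CriticalPhenomena.PercolationContinuityZ3.Theorems.FK

open Literature.Probability.Percolation Literature.Probability.LatticeModels SimpleGraph
open Literature.Probability.Percolation.GadgetSystem Literature.Probability.Percolation.KozmaNitzan
open Literature.Barriers.CriticalPhenomena

variable {d : ℕ}

/-! ### 1. Placed slabs: the slab box `S(L, N)` after a coordinate permutation and a translation -/

/-- **Membership in a placed slab** `σ_π S(L,N) + v` (`σ_π` the coordinate permutation `x ↦ (x_{π⁻¹ i})_i`): the
`π j`-th coordinate of `y - v` is bounded by the `j`-th half-width of `S(L, N)`.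
[cite: Grimmett2006, §5.7 (the slabs S(L,n) and their images under automorphisms, proof of Thm. (5.104))] -/
theorem mem_image_signedPerm_add_iff (π : Equiv.Perm (Fin d)) (v : Site d) (L N : ℕ) (y : Site d) :
    y ∈ (fkSlab d L N).image (fun x => Site.signedPerm π 1 x + v) ↔
      ∀ j, -(fkSlabHalfWidth d L N j : ℤ) ≤ y (π j) - v (π j) ∧ y (π j) - v (π j) ≤ fkSlabHalfWidth d L N j := by
  constructor
  · intro h j
    obtain ⟨x, hx, rfl⟩ := Finset.mem_image.1 h
    have := (mem_fkSlab.1 hx) j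
    simp only [Pi.add_apply, Site.signedPerm_apply, Pi.one_apply, Units.val_one, one_mul,
      Equiv.symm_apply_apply, add_sub_cancel_right]
    exact this
  · intro h
    refine Finset.mem_image.2 ⟨(Site.signedPerm π 1).symm (y - v), mem_fkSlab.2 fun j => ?_, ?_⟩
    · simp only [Site.signedPerm_symm_apply, Pi.one_apply, Units.val_one, one_mul, Pi.sub_apply]
      exact h j
    · rw [Equiv.apply_symm_apply, sub_add_cancel]

/-- A placed slab whose offset leaves room lies inside the box `Λ_N`. [cite: Grimmett2006, §5.7 (proof of Thm. (5.104): the slabs inside Λ_N)] -/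
theorem image_signedPerm_add_subset_box (π : Equiv.Perm (Fin d)) (v : Site d) {L N : ℕ}
    (hv : ∀ j, |v (π j)| + (fkSlabHalfWidth d L N j : ℤ) ≤ N) :
    (fkSlab d L N).image (fun x => Site.signedPerm π 1 x + v) ⊆ box d N := by
  intro y hy
  rw [mem_box]
  intro i
  have h := (mem_image_signedPerm_add_iff π v L N y).1 hy (π.symm i)
  have hv' := hv (π.symm i)
  rw [Equiv.apply_symm_apply] at h hv'
  have h1 := le_abs_self (v i)
  have h2 := neg_abs_le (v i)
  constructor <;> linarith [h.1, h.2]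

/-- Two placed slabs (same permutation) whose offsets differ by more than twice the half-width in some slab
direction are disjoint. [cite: Grimmett2006, §5.7 (proof of Thm. (5.104): disjoint slabs)] -/
theorem disjoint_image_signedPerm_add (π : Equiv.Perm (Fin d)) (v v' : Site d) (L N : ℕ) (j₀ : Fin d)
    (h : 2 * (fkSlabHalfWidth d L N j₀ : ℤ) < |v (π j₀) - v' (π j₀)|) :
    Disjoint ((fkSlab d L N).image (fun x => Site.signedPerm π 1 x + v))
      ((fkSlab d L N).image (fun x => Site.signedPerm π 1 x + v')) := by
  rw [Finset.disjoint_left]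
  intro y hy hy'
  have h1 := (mem_image_signedPerm_add_iff π v L N y).1 hy j₀
  have h2 := (mem_image_signedPerm_add_iff π v' L N y).1 hy' j₀
  have h3 : |v (π j₀) - v' (π j₀)| ≤ 2 * (fkSlabHalfWidth d L N j₀ : ℤ) :=
    abs_le.2 ⟨by linarith [h1.1, h2.2], by linarith [h1.2, h2.1]⟩
  linarith

/-- **The far point of a placed slab lies on the quarter face**: for `c ≠ a`, `0 ≤ τ_c k`, `|k| ≤ ℓ`, the point
`τ_a ℓ e_a + k e_c` belongs to the target `ℓF` of the quarter-face geometry of direction `a` and signs `τ`.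
[cite: KozmaNitzan2024, §4 Lemma 9 (p. 16) (F = {1} × [0,1]^{d-1} and its images)] -/
theorem single_add_single_mem_qfGeom_Fset {a c : Fin d} (hca : c ≠ a) (τ : Fin d → ℤˣ) {ℓ : ℕ} {k : ℤ}
    (hk0 : 0 ≤ (τ c : ℤ) * k) (hk : |k| ≤ ℓ) :
    (Pi.single a ((τ a : ℤ) * ℓ) + Pi.single c k : Site d) ∈ (qfGeom a τ).Fset ℓ 0 := by
  have hτa : (τ a : ℤ) * (τ a : ℤ) = 1 := by
    rcases Int.units_eq_one_or (τ a) with h | h <;> simp [h]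
  have hk' := abs_le.1 hk
  rw [mem_qfGeom_Fset_iff, mem_orthantFace, mem_box]
  refine ⟨fun i => ?_, ?_, fun j hj => ?_⟩
  · simp only [Pi.add_apply, Pi.single_apply]
    by_cases hia : i = a
    · subst hia
      rw [if_pos rfl, if_neg hca.symm, add_zero]
      rcases Int.units_eq_one_or (τ i) with h | h <;> simp [h]
    · rw [if_neg hia, zero_add]
      split_ifs
      · exact hk'
      · constructor <;> omega
  · simp only [Pi.add_apply, Pi.single_eq_same, Pi.single_apply, if_neg hca.symm, add_zero, ← mul_assoc, hτa,
      one_mul]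
  · simp only [Pi.add_apply, Pi.single_apply, if_neg hj, zero_add]
    split_ifs with hjc
    · subst hjc; exact hk0
    · simp

/-! ### 2. Free slab percolation makes every quarter-face geometry FK-hittable (`Π(p, L) ⟹ FH`) -/

/-- **Free slab percolation at thickness `L` makes the quarter-face geometry FK-hittable** (`d ≥ 3`, `q ≥ 1`): if
`Π(p, L)` holds (`FKSlabPercolation d p q L`: `φ⁰_{S(L,N),p,q}(0 ↔ x) > α` for all `N`, `x ∈ S(L,N)`; Grimmett (5.102),
Pisztora's (SP)), then for `ε > 0`, with `(1 - α)^n < ε` and `k = ℓ₀ = (2L+1)n + L`, for all `m ≥ k`, `ℓ ≥ ℓ₀` the free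
look of the quarter-face geometry `(a, τ)` succeeds with probability `> 1 - ε`: inside `ℓQ = Λ_ℓ` the `n` disjoint slabs
`σ_π S(L, ℓ) + k_i e_c` (`π = (a, d-1)` makes `a` a long direction, `c = π 0` is thin, `k_i = τ_c (2L+1) i`) each contain
the seed vertex `k_i e_c ∈ Λ_m` and the face vertex `τ_a ℓ e_a + k_i e_c ∈ ℓF`, joined under the slab's own FREE law with
probability `φ⁰_{S(L,ℓ)}(0 ↔ τ_a ℓ e_{d-1}) > α` (covariance under `Aut(ℤ^d)`); the sequential free trials
(`one_sub_pow_le_fkLaw_real_linkIn` = Grimmett (5.113)–(5.116)) give `φ(Λ_m ↔ ℓF in ℓQ) ≥ 1 - (1-α)^n > 1 - ε`.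
[cite: Grimmett2006, §5.7 eq. (5.102), Thm. (5.104) proof (5.113)–(5.116); Thm. (3.7); eq. (3.22); Lemma (4.13)]
[cite: KozmaNitzan2024, §4 p. 16 (hittable geometry), Lemma 9] [cite: Pisztora1996, §1 (slab percolation (SP) and renormalisation)] -/
theorem isHittableFK_qfGeom_of_fkSlabPercolation (hd : 3 ≤ d) {q : ℝ} (hq : 1 ≤ q) {p : unitInterval} {L : ℕ}
    (hSP : FKSlabPercolation d (p : ℝ) q L) (a : Fin d) (τ : Fin d → ℤˣ) : IsHittableFK q p (qfGeom a τ) := by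
  have hq0 : 0 < q := one_pos.trans_le hq
  obtain ⟨α, hα0, hαlt⟩ := hSP
  have hα1 : α < 1 := by -- a slab connectivity is a probability
    haveI := isProbabilityMeasure_rcMeasure (finsetGraph (zdGraph d) (fkSlab d L 0)) p.2 hq0 (∅ : Set (FKSlabV d L 0))
    exact (hαlt 0 (fkSlabCentre d L 0)).trans_le measureReal_le_one
  refine ⟨fun ε hε => ?_⟩
  obtain ⟨n, hn⟩ := exists_pow_lt_of_lt_one hε (by linarith : 1 - α < 1)
  refine ⟨(2 * L + 1) * n + L, (2 * L + 1) * n + L, fun m hm ℓ hℓ => ?_⟩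
  have hm' : (2 * (L : ℤ) + 1) * n + L ≤ m := by exact_mod_cast hm
  have hℓ' : (2 * (L : ℤ) + 1) * n + L ≤ ℓ := by exact_mod_cast hℓ
  have hLℓ : L ≤ ℓ := le_trans (Nat.le_add_left L _) hℓ
  -- the frame: `π` swaps the face direction `a` with the last coordinate (a long direction of `S(L, ℓ)`);
  -- `c = π 0` is a thin direction of the placed slabs, along which they are stacked
  have hd1 : d - 1 < d := by omega
  have hd0 : 0 < d := by omega
  set last : Fin d := ⟨d - 1, hd1⟩ with hlast
  set z0 : Fin d := ⟨0, hd0⟩ with hz0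
  set π : Equiv.Perm (Fin d) := Equiv.swap a last with hπ
  set c : Fin d := π z0 with hc
  have hπlast : π last = a := Equiv.swap_apply_right a last
  have hca : c ≠ a := by
    intro h
    have h' : π z0 = π last := by rw [← hc, h, hπlast]
    have := congrArg Fin.val (π.injective h')
    rw [hz0, hlast] at this
    simp only at this
    omega
  have hπj : ∀ j, π j = c ↔ j = z0 := fun j => by rw [hc]; exact π.injective.eq_iff
  have hwz0 : fkSlabHalfWidth d L ℓ z0 = L := by
    simp only [fkSlabHalfWidth, hz0]; rw [if_neg (by omega)]
  have hwlast : d ≤ last.val + 2 := by simp only [hlast]; omega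
  have hwle : ∀ j, (fkSlabHalfWidth d L ℓ j : ℤ) ≤ ℓ := fun j => by
    unfold fkSlabHalfWidth
    split_ifs
    · exact le_rfl
    · exact_mod_cast hLℓ
  have hτabs : ∀ u : ℤˣ, |(u : ℤ)| = 1 := fun u => by
    rcases Int.units_eq_one_or u with h | h <;> simp [h]
  have hτsq : ∀ u : ℤˣ, (u : ℤ) * (u : ℤ) = 1 := fun u => by
    rcases Int.units_eq_one_or u with h | h <;> simp [h]
  -- the placed slabs: offsets `k_i = τ_c (2L+1) i` along `c`
  set σ : Site d ≃ Site d := Site.signedPerm π 1 with hσ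
  set kk : ℕ → ℤ := fun i => (τ c : ℤ) * ((2 * (L : ℤ) + 1) * (i : ℤ)) with hkk
  set v : ℕ → Site d := fun i => Pi.single c (kk i) with hv
  set gI : ℕ → zdGraph d ≃g zdGraph d := fun i => (zdSignedPermIso π 1).trans (zdShiftIso (v i)) with hgI
  have hgIapp : ∀ i x, gI i x = σ x + v i := fun i x => rfl
  have hgIimg : ∀ i, (fkSlab d L ℓ).image (gI i) = (fkSlab d L ℓ).image (fun x => σ x + v i) := fun i => rfl
  set x₀ : Site d := Pi.single last ((τ a : ℤ) * ℓ) with hx₀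
  have hx₀mem : x₀ ∈ fkSlab d L ℓ :=
    single_mem_fkSlab_of_abs_le last hwlast (by rw [abs_mul, hτabs, one_mul, Nat.abs_cast])
  have hkabs : ∀ i, |kk i| = (2 * (L : ℤ) + 1) * (i : ℤ) := fun i => by
    simp only [hkk]; rw [abs_mul, hτabs, one_mul, abs_of_nonneg (by positivity)]
  have hkpos : ∀ i, 0 ≤ (τ c : ℤ) * kk i := fun i => by
    simp only [hkk]; rw [← mul_assoc, hτsq, one_mul]; positivity
  have hkle : ∀ i < n, |kk i| + (2 * (L : ℤ) + 1) ≤ (2 * (L : ℤ) + 1) * n := fun i hi => by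
    rw [hkabs]
    have h1 : (i : ℤ) + 1 ≤ n := by exact_mod_cast Nat.succ_le_of_lt hi
    nlinarith [mul_le_mul_of_nonneg_left h1 (by positivity : (0 : ℤ) ≤ 2 * (L : ℤ) + 1)]
  have hvπ : ∀ i j, v i (π j) = if j = z0 then kk i else 0 := fun i j => by
    simp only [hv, Pi.single_apply, hπj j]
  have hSQ : ∀ i < n, (fkSlab d L ℓ).image (gI i) ⊆ (qfGeom a τ).Qset ℓ 0 := by
    intro i hi
    rw [qfGeom_Qset, hgIimg]
    refine image_signedPerm_add_subset_box π (v i) fun j => ?_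
    rw [hvπ]
    split_ifs with hj
    · rw [hj, hwz0]; linarith [hkle i hi]
    · rw [abs_zero, zero_add]; exact hwle j
  have hdisj : ∀ i < n, ∀ j < n, i ≠ j →
      Disjoint ((fkSlab d L ℓ).image (gI i)) ((fkSlab d L ℓ).image (gI j)) := by
    intro i hi j hj hij
    rw [hgIimg, hgIimg]
    refine disjoint_image_signedPerm_add π (v i) (v j) L ℓ z0 ?_
    rw [hwz0, hvπ, hvπ, if_pos rfl, if_pos rfl]
    simp only [hkk]
    rw [← mul_sub, abs_mul, hτabs, one_mul]
    rcases lt_or_gt_of_ne hij with h | h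
    · have h1 : (i : ℤ) + 1 ≤ j := by exact_mod_cast Nat.succ_le_of_lt h
      have h2 := mul_le_mul_of_nonneg_left h1 (by positivity : (0 : ℤ) ≤ 2 * (L : ℤ) + 1)
      rw [abs_sub_comm, abs_of_nonneg (by nlinarith)]
      nlinarith
    · have h1 : (j : ℤ) + 1 ≤ i := by exact_mod_cast Nat.succ_le_of_lt h
      have h2 := mul_le_mul_of_nonneg_left h1 (by positivity : (0 : ℤ) ≤ 2 * (L : ℤ) + 1)
      rw [abs_of_nonneg (by nlinarith)]
      nlinarith
  have hs : ∀ i < n, gI i 0 ∈ GM.ball (0 : Site d) m := by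
    intro i hi
    rw [hgIapp, hσ, Site.signedPerm_zero, zero_add, GM.mem_ball]
    intro i'
    simp only [hv, Pi.zero_apply, sub_zero, Pi.single_apply]
    split_ifs
    · have := abs_le.1 (show |kk i| ≤ m by linarith [hkle i hi]); exact this
    · exact ⟨neg_nonpos.2 (by positivity), by positivity⟩
  have ht : ∀ i < n, gI i x₀ ∈ (qfGeom a τ).Fset ℓ 0 := by
    intro i hi
    rw [hgIapp, hσ, hx₀, signedPerm_one_single, hπlast]
    exact single_add_single_mem_qfGeom_Fset hca τ (hkpos i) (by linarith [hkle i hi])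
  have hW : ∀ i < n, ∀ e ∈ wireSet (↑((fkSlab d L ℓ).image (gI i)) : Set (Site d)),
      lattW d p e ≤ hitW p (qfGeom a τ) ℓ m 0 e := by
    intro i hi e he
    exact lattW_le_hitW_of_mem_wireSet p (qfGeom a τ) ℓ m 0
      ⟨fun x hx => Finset.mem_coe.2 (hSQ i hi (Finset.mem_coe.1 (he.1 x hx))), he.2⟩
  -- (vi) each slab alone, under its free law, joins its seed vertex to its face vertex with probability `> α`
  have hα : ∀ i < n, α ≤ (fkLaw ((fkSlab d L ℓ).image (gI i))
      (restrW (↑((fkSlab d L ℓ).image (gI i)) : Set (Site d)) (lattW d p)) q).real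
        (openConnIn (↑((fkSlab d L ℓ).image (gI i)) : Set (Site d)) (gI i 0) (gI i x₀)) := by
    intro i _
    rw [fkLaw_image_iso_restrW_lattW_real_openConnIn (gI i) (fkSlab d L ℓ) p hq0 0 x₀]
    have h2 := hαlt ℓ ⟨x₀, hx₀mem⟩
    rw [← fkLaw_fkSlab_real_openConnIn p hq0 L ℓ ⟨x₀, hx₀mem⟩] at h2
    exact h2.le
  -- sequential free trials
  have key := one_sub_pow_le_fkLaw_real_linkIn hq p ((qfGeom a τ).Qset ℓ 0) (hitW p (qfGeom a τ) ℓ m 0)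
    (S := fun i => (fkSlab d L ℓ).image (gI i)) (s := fun i => gI i 0) (t := fun i => gI i x₀)
    hSQ hdisj hs ht hW hα
  exact lt_of_lt_of_le (by linarith) key

/-- **`Π(p, L) ⟹ FH`** — free slab percolation at the same `p` gives the hypothesis of record (`d ≥ 3`, `q ≥ 1`):
every quarter-face geometry is FK-hittable. The SUFFICIENCY side of the calibration K1 at the level of slabs:
what the record's binder 1 asks of the free measure at `p` is implied by Grimmett's slab property `Π(p, L)`.
[cite: Grimmett2006, §5.7 eq. (5.102), Thm. (5.104) proof (5.113)–(5.116); KozmaNitzan2024, §4 Lemma 9 (p. 16)] -/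
theorem fh_of_fkSlabPercolation (hd : 3 ≤ d) {q : ℝ} (hq : 1 ≤ q) {p : unitInterval} {L : ℕ}
    (hSP : FKSlabPercolation d (p : ℝ) q L) : FH d q p := by
  intro g hg
  obtain ⟨x, -, rfl⟩ := List.mem_map.1 hg
  exact isHittableFK_qfGeom_of_fkSlabPercolation hd hq hSP x.1 x.2

/-! ### 3. Above the slab threshold `p̂_c(q)` binder 1 holds; the Conjecture (5.103) form -/

/-- **`p̂_c(q) < p ⟹ FH d q p`** (`d ≥ 3`, `q ≥ 1`): above the slab threshold `p̂_c(q) = fkSlabCriticalProb d q`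
((5.102)) binder 1 holds — some `p' < p` has `Π(p', L)`, and `Π` is monotone in `p`. With T1c's `rcCriticalProb_le_of_fh`
the threshold of binder 1 lies in `[p_c(q), p̂_c(q)]`. [cite: Grimmett2006, §5.7 eq. (5.102), Conj. (5.103); Severo2024, §1 (p̂_c)] -/
theorem fh_of_fkSlabCriticalProb_lt (hd : 3 ≤ d) {q : ℝ} (hq : 1 ≤ q) {p : unitInterval}
    (h : fkSlabCriticalProb d q < (p : ℝ)) : FH d q p := by
  have hq0 : 0 < q := one_pos.trans_le hq
  obtain ⟨p', ⟨hp', L, hL⟩, hp'p⟩ := exists_lt_of_csInf_lt ⟨1, one_mem_fkSlabCriticalSet hq0⟩ h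
  exact fh_of_fkSlabPercolation hd hq (hL.mono hp' p.2 hp'p.le hq)

/-- Contrapositive: where binder 1 fails, `p ≤ p̂_c(q)`. [cite: Grimmett2006, §5.7 eq. (5.102)] -/
theorem le_fkSlabCriticalProb_of_not_fh (hd : 3 ≤ d) {q : ℝ} (hq : 1 ≤ q) {p : unitInterval} (h : ¬ FH d q p) :
    (p : ℝ) ≤ fkSlabCriticalProb d q := not_lt.1 fun hlt => h (fh_of_fkSlabCriticalProb_lt hd hq hlt)

/-- **The Conjecture (5.103) form**: if `p̂_c(q) = p_c(q)` for this `q` (Conj. (5.103), in print a theorem for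
`q ∈ {1, 2}` only; displayed hypothesis, NOT asserted), binder 1 holds at every `p > p_c(q)` (and fails at every
`p < p_c(q)`, T1c `not_fh_of_lt_rcCriticalProb`). [cite: Grimmett2006, §5.7 Conj. (5.103); DuminilCopinTassion2019, §5 Question 5] -/
theorem fh_of_rcCriticalProb_lt_of_slabThreshold_eq (hd : 3 ≤ d) {q : ℝ} (hq : 1 ≤ q)
    (h5103 : fkSlabCriticalProb d q = rcCriticalProb d q) {p : unitInterval} (hlt : rcCriticalProb d q < (p : ℝ)) :
    FH d q p :=
  fh_of_fkSlabCriticalProb_lt hd hq (h5103 ▸ hlt)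

/-- **Same-`p` slab criterion ⟹ T1c's converse for binder 1** (general `q ≥ 1`, `d ≥ 3`): if at this `p` free
percolation forces free slab percolation (`0 < θ⁰(p,q) → ∃ L, Π(p, L)` — Pisztora's (P) ⟹ (SP), Wouts' "fundamental
question", the displayed hypothesis of the barrier theorem `samePFreeBoundaryCriteria`; OPEN for `q ∉ {1, 2}`), then
`0 < θ⁰(p,q) → FH d q p`, i.e. together with T1c's `thetaFree_pos_of_fh`: `FH d q p ↔ 0 < θ⁰(p,q)` at this `p`. The
binder-1 half of T1c's "open content `0 < θ⁰(p,q) ⟹ FH ∧ TP_FK`" is thus EXACTLY the same-`p` slab criterion.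
[cite: Grimmett2006, §5.7 Conj. (5.103), Thm. (5.104) proof (5.113)–(5.116); Pisztora1996, §1 ((P), (SP))] -/
theorem fh_iff_thetaFree_pos_of_samePFreeSlab (hd : 3 ≤ d) {q : ℝ} (hq : 1 ≤ q) {p : unitInterval}
    (hPSP : 0 < thetaFree d p q → ∃ L : ℕ, FKSlabPercolation d (p : ℝ) q L) :
    FH d q p ↔ 0 < thetaFree d p q := by
  haveI : NeZero d := ⟨by omega⟩
  refine ⟨thetaFree_pos_of_fh hq, fun hθ => ?_⟩
  obtain ⟨L, hL⟩ := hPSP hθ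
  exact fh_of_fkSlabPercolation hd hq hL

/-! ### 4. The Ising case `q = 2`: binder 1 is DECIDED (given Bodineau's theorem `p̂_c(2) = p_c(2)`) -/

/-- **`q = 2`, `d ≥ 3`: binder 1 holds at every `p > p_c(2)`**, given Bodineau's theorem (named fact
`Bodineau2005_slabThreshold : p̂_c(2) = p_c(2)`, Bodineau 2005 Thm. 2.1 / Severo 2024 Thm. 1.1 — a PUBLISHED theorem
taken as a displayed hypothesis; the tree does not prove it). CONDITIONAL on that named fact only.
[cite: Bodineau2005, Thm. 2.1; Severo2024, Thm. 1.1; Grimmett2006, Thm. (5.104) proof (5.113)–(5.116)] -/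
theorem fh_two_of_rcCriticalProb_lt (hB : Bodineau2005_slabThreshold) (hd : 3 ≤ d) {p : unitInterval}
    (hlt : rcCriticalProb d 2 < (p : ℝ)) : FH d 2 p := by
  obtain ⟨L, hL⟩ := hB.fkSlabPercolation hd p.2 hlt
  exact fh_of_fkSlabPercolation hd (by norm_num) hL

/-- **`q = 2`, `d ≥ 3`: the truth set of binder 1 is exactly `(p_c(2), 1]`** (given Bodineau's theorem): `FH d 2 p ↔
p_c(2) < p` — above `p_c(2)` by `fh_two_of_rcCriticalProb_lt`, at `p_c(2)` it fails (`not_fh_two_at_critical`, T1c,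
continuity of the Ising magnetisation, ADS 2015), below `p_c(2)` it fails (`not_fh_of_lt_rcCriticalProb`, T1c).
[cite: Bodineau2005, Thm. 2.1; Severo2024, Thm. 1.1; AizenmanDuminilCopinSidoraviciusCMP2015, Thm. 1.2] -/
theorem fh_two_iff_rcCriticalProb_lt (hB : Bodineau2005_slabThreshold) (hd : 3 ≤ d) {p : unitInterval} :
    FH d 2 p ↔ rcCriticalProb d 2 < (p : ℝ) := by
  haveI : NeZero d := ⟨by omega⟩
  refine ⟨fun h => ?_, fh_two_of_rcCriticalProb_lt hB hd⟩
  rcases (rcCriticalProb_le_of_fh (by norm_num) h).lt_or_eq with hlt | heq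
  · exact hlt
  · exfalso
    have hp : p = ⟨rcCriticalProb d 2, rcCriticalProb_mem_Icc d 2⟩ := Subtype.ext heq.symm
    exact not_fh_two_at_critical hd (hp ▸ h)

/-- **`q = 2`, `d ≥ 3`: binder 1 is EQUIVALENT to free percolation at the same `p`** (given Bodineau's theorem):
`FH d 2 p ↔ 0 < θ⁰(p, 2)` — the necessity side is T1c's `thetaFree_pos_of_fh` (every `q ≥ 1`); the sufficiency
side is the barrier note's `samePFreeSlab_two_of_bodineau` (`0 < θ⁰(p,2) ⟹ ∃ L, Π(p, L)`) followed by
`fh_of_fkSlabPercolation`. For `q = 2` the programme's open content `0 < θ⁰(p,q) ⟹ FH ∧ TP_FK` (T1c) thus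
reduces to its TP_FK half. [cite: Bodineau2005, Thm. 2.1; Severo2024, Thm. 1.1; Grimmett2006, §5.1 (5.1), Conj. (5.103)] -/
theorem fh_two_iff_thetaFree_pos (hB : Bodineau2005_slabThreshold) (hd : 3 ≤ d) {p : unitInterval} :
    FH d 2 p ↔ 0 < thetaFree d p 2 := by
  haveI : NeZero d := ⟨by omega⟩
  refine ⟨thetaFree_pos_of_fh (by norm_num), fun hθ => ?_⟩
  obtain ⟨L, hL⟩ := samePFreeSlab_two_of_bodineau hB hd p.2 hθ
  exact fh_of_fkSlabPercolation hd (by norm_num) hL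

/-- **The record at `q = 2` with ONE open binder** (given Bodineau's theorem): for `d ≥ 3`, `ε₀ > 0` and every
`p ∈ (p_c(2), 1)`, the FK target property `KNFreeTargetHittable d 2 p` (TP_FK, binder 2 — OPEN) ALONE gives the
uniform finite-size criterion `∃ r, UFSC0 d 2 p r ε₀` — the record `ufsc0_of_freeBoundaryHypothesis_r3` with its
binder `hFH` instantiated by `fh_two_of_rcCriticalProb_lt`. CONDITIONAL on TP_FK and on the named fact; NOT a re-cut
of the record (whose binders are for general `q ≥ 1`), not `_r4`. Third one-line consumer of the record
`ufsc0_of_freeBoundaryHypothesis_r3` (after `rcCriticalProb_lt_of_fh_of_targetHittable` :71 and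
`fkCriterionOfThetaFree_of_converse`): at `q = 2`, `d ≥ 3` and `p > p_c(2)` binder 1 is supplied by Bodineau's slab
theorem (displayed named fact `hB`), so the Ising-case record needs binder 2 `KNFreeTargetHittable d 2 p` ALONE — which
stays OPEN at every such `p` (barrier note FBN-01, K1); a CALIBRATION of what remains open, not a discharge of either
binder (R58 (β)). [cite: KozmaNitzan2024, §4 Theorem 6 (pp. 25–31); Bodineau2005, Thm. 2.1; Grimmett2006, Conj. (5.103)] -/
theorem ufsc0_two_of_targetHittable (hB : Bodineau2005_slabThreshold) (hd : 3 ≤ d) {ε₀ : ℝ} (hε₀ : 0 < ε₀)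
    (p : unitInterval) (hp : (p : ℝ) ∈ Set.Ioo 0 1) (hlt : rcCriticalProb d 2 < (p : ℝ))
    (h_tgt : KNFreeTargetHittable d 2 p) : ∃ r : ℕ, UFSC0 d 2 p r ε₀ :=
  ufsc0_of_freeBoundaryHypothesis_r3 hd (by norm_num) hε₀ p hp (fh_two_of_rcCriticalProb_lt hB hd hlt) h_tgt

end Summit.CriticalPhenomena.PercolationContinuityZ3.Theorems.FK

end
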